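import Mathlib

/-!
# Bałaban, *Propagators and renormalization transformations for lattice gauge theories. I*
(Commun. Math. Phys. **95** (1984) 17–40) — p. 28, display (1.63): the two printed expressions of the
momentum representation of `H_kB` AGREE (the second follows from the first), kernel-checked as a
finite-sum identity over the alias fibre `{p′ + l}`

[cite: Balaban1984PropagatorsI, (1.61)–(1.63) p.28]

## The printed text (render `1984-cmp95-propagators-rt-I-p012-x2.png` = journal p. 28 [PDF 12], read as an image)

«Let us write this operator in momentum representation.
  (Q_kA)~_μ(p′) = Σ_l u(p′+l) v_μ(p′+l) Ã_μ(p′+l),  v_μ(p) = ∂¹_μ(p′)/∂_μ(p),   (1.61)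
and operator φ as
  (φω)~_μ(p′) = φ_μ(p′) ω̃_μ(p′),  φ_μ(p′) = Σ_l |u(p′+l)|² |v_μ(p′+l)|² / Δ(p′+l),   (1.62)
where we have omitted the subscript k. Multiplying φ_μ(p′) by Δ₀(p′), we get a well-defined positive
function for all p′ ∈ T̃₁^{(k)}, 0 < γ₀ ≤ Δ₀(p′)φ_μ(p′) ≤ γ₁. We have the following momentum
representation for H_kB:
  (H_kB)~_μ(p′+l) = Δ₀(p′)/Δ(p′+l) · \overline{u(p′+l)v_μ(p′+l)} · 1/(Δ₀(p′)φ_μ(p′)) · B̃_μ(p′)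
    + [ ∂_μ(p′+l) \overline{u(p′+l)} Δ₀²(p′)/Δ²(p′+l) · ( Σ_{l′} |u(p′+l′)|² Δ₀²(p′)/Δ²(p′+l′) )⁻¹
        − \overline{u(p′+l)v_μ(p′+l)} Δ₀(p′)/Δ(p′+l) · 1/(Δ₀(p′)φ_μ(p′)) · \overline{∂¹_μ(p′)} ]
      · ( Σ_{ν=1}^d |∂¹_ν(p′)|²/(Δ₀²(p′)φ_ν(p′)) )⁻¹ Σ_{λ=1}^d ∂¹_λ(p′)/(Δ₀(p′)φ_λ(p′)) Δ₀⁻¹(p′) B̃_λ(p′)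
  = Δ₀(p′)/Δ(p′+l) · \overline{u(p′+l)v_μ(p′+l)} · 1/(Δ₀(p′)φ_μ(p′)) · B̃_μ(p′)
    + Σ_{l′≠l} ∂_μ(p′+l) \overline{u(p′+l)} |u(p′+l′)|² / (Δ(p′+l)Δ(p′+l′)) · Δ₀²(p′)
      · [ |v_μ(p′+l′)|²/Δ(p′+l) − |v_μ(p′+l)|²/Δ(p′+l′) ] ( Σ_{l″} |u(p′+l″)|² Δ₀²(p′)/Δ²(p′+l″) )⁻¹
      · 1/(Δ₀(p′)φ_μ(p′)) ( Σ_{ν=1}^d |∂¹_ν(p′)|²/(Δ₀²(p′)φ_ν(p′)) )⁻¹ Σ_{λ=1}^d \overline{∂¹_λ(p′)}/(Δ₀(p′)φ_λ(p′)) B̃_λ(p′).   (1.63)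
This expression is well defined and bounded for all values of l and p′, including p′ = 0 where it is
defined as a limit for p′ → 0.»

CONJUGATION BARS (cell GAPS G-B5-14 (ii), a print slip): in the FIRST expression print carries a bar
on `∂¹_μ(p′)` inside the bracket and NO bar on `∂¹_λ(p′)` in `Σ_λ`; (1.60) (`… − Δ⁻¹Q_k*φ⁻¹∂₁](∂₁*φ⁻¹∂₁)⁻¹
∂₁*φ⁻¹B′`, with `∂₁` acting by the symbol `∂¹_μ(p′)` and `∂₁*` by `\overline{∂¹_λ(p′)}`) and the
SECOND expression (bar on `∂¹_λ(p′)`) have them the other way round. This module reads the first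
expression with the bars of (1.60)/(1.62)/second expression (`first163`), and ALSO types the printed
placement (`firstPrinted163`, §3) to record exactly when the two readings coincide.

## What this module certifies (kernel), and what it does not — HONEST SCOPE

Over an ARBITRARY finite alias-index type `ι` (in print `l ∈ 2πℤ^d ∩ T_η`-representatives, `|ι| =
L^{kd}`), an arbitrary finite direction type `κ` (print: `{1, …, d}`), a fixed direction `μ : κ`, and
arbitrary complex families — `u l = u(p′+l)`, `v l = v_μ(p′+l)`, `dμ l = ∂_μ(p′+l)`, `D l = Δ(p′+l)`,
`dOne ν = ∂¹_ν(p′)`, `phiDir ν = φ_ν(p′)` (a spectator family: only `φ_μ(p′)`, written out by (1.62) as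
`phiSym u v D`, enters the computation), `Bt ν = B̃_ν(p′)`, `Δ₀ = Δ₀(p′)`:

* §1 `conj_div_mul` / `conj_mul_of_eq_mul`: for `v = ∂¹/∂` as in (1.61) (or any `v` with
  `∂¹_μ(p′) = v_μ(p′+l)∂_μ(p′+l)`, the multiplicative reading that includes the removable point
  `∂_μ(p′+l) = 0`, cf. the lineage's `B5Prop11Fiber.d1Sym_eq_vSym_mul`),
  `\overline{v_μ(p′+l)} ∂¹_μ(p′) = ∂_μ(p′+l) |v_μ(p′+l)|²` — the one-line identity behind the passage
  from the first to the second expression (cell prose certificate GAPS C-adv4-31: «using v̄_μ(p′+l)∂¹_μ(p′)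
  = ∂_μ(p′+l)|v_μ(p′+l)|²»).
* §2 `summand_self` : the `l′ = l` summand of the second expression vanishes identically, so
  `Σ_{l′≠l} = Σ_{l′}` (`sum_erase_eq_sum`); `sum_second_eq`: that sum in closed form;
  `first163_eq_second163` (MAIN): under `Δ₀(p′) ≠ 0`, `S(p′) := Σ_{l′}|u(p′+l′)|²Δ₀²/Δ²(p′+l′) ≠ 0`,
  `φ_μ(p′) ≠ 0` and the §1 relation at `l` (variants `…_of_eq_mul`: (1.61) read multiplicatively;
  `…_vOf`: `v = ∂¹/∂` literally, no relation hypothesis), the bar-corrected FIRST expression EQUALS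
  the SECOND at every alias `l` — the printed `Δ₀²(p′)` of the second expression being `Δ₀³·Δ₀⁻¹`
  with the tail factor `Δ₀⁻¹(p′)` of the first expression absorbed (C-adv4-31); the `l′`-independent
  factors `S⁻¹·(Δ₀φ_μ)⁻¹·N⁻¹·Σ_λ` are written outside the `l′`-sum. No hypothesis on `Δ(p′+l)`,
  `φ_ν`, `B̃`, or the `ν`-sum is needed (they are common factors; Lean's `x/0 = 0` convention makes
  the identity total in them).
* §2 `first163_eq_second163_of_pos`: the same with the nonvanishing hypotheses discharged from REAL
  data `Δ(p′+l) > 0`, `Δ₀(p′) > 0` and one `l₀` with `u(p′+l₀)v_μ(p′+l₀) ≠ 0` (`sSym_ne_zero`,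
  `phiSym_ne_zero`) — the shape of «we get a well-defined positive function … 0 < γ₀ ≤ Δ₀(p′)φ_μ(p′)»;
  the BOUNDS `γ₀, γ₁` themselves are NOT this module (lineage: `B5Bounds167Lattice.Delta0_phi162_bounds`).
* §3 `firstPrinted163_eq_first163`: with the PRINTED bars the first expression coincides with the
  corrected one whenever every `∂¹_ν(p′)` is real (`e^{ip′_ν} = ±1`) — exactly the agreement pattern
  found numerically by the cell's second engine (B5.lean header, E6b: agreement to 1e-14 at those
  momenta, 46–72 % deviation elsewhere). That the printed reading is FALSE in general is a numerical
  finding of the cell (kit job j038533), not a theorem of this module.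

NOT certified here: that (1.63) IS the momentum representation of the operator (1.60) for Bałaban's
`Q_k`, `∂`, `Δ`, `φ` on `T_η` (the Fourier dictionary (1.29)/(1.61)/(1.62); the lineage's typed symbols
are `B5Prop11Fiber.uSym/vSym/dSym/d1Sym`, `B4Strip.DeltaXir/Delta1r`, `B5Bounds167Lattice.phi162`, not
imported — this module is deliberately symbol-agnostic); the two sentences after (1.63) (the limit
`p′ → 0`; the `l`-sum bound with `|∂_ν(p′+l)||p′+l|^α`, cell gap G-adv4-9); anything of Prop. 1.1/1.2.
VALUE = a kernel certificate that two printed displays agree (third engine for G-B5-14 (ii) / C-adv4-31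
/ C-B5-9 E6b), NOT summit progress.

Tags: `[cite: …]` marks a definition typed verbatim from the cited display; `[folklore]` marks
finite-sum algebra.
-/

namespace Literature.MathematicalPhysics.QuantumFieldTheory.Balaban1983to89.B5Symbol163

open scoped BigOperators ComplexConjugate
open Finset Complex

noncomputable section

variable {ι : Type*} [Fintype ι] [DecidableEq ι] {κ : Type*} [Fintype κ]

/-! ## §1. (1.61), (1.62) and the conjugation identity -/

/-- (1.61): `v_μ(p′+l) = ∂¹_μ(p′)/∂_μ(p′+l)` (`dOneμ = ∂¹_μ(p′)`, `dμ l = ∂_μ(p′+l)`; Lean's `x/0 = 0`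
at the removable point). [cite: Balaban1984PropagatorsI, (1.61) p.28] -/
def vOf (dOneμ : ℂ) (dμ : ι → ℂ) (l : ι) : ℂ := dOneμ / dμ l

/-- `\overline{(a/b)}·a = b·|a/b|²` for all complex `a, b` (also `b = 0`). [folklore] -/
theorem conj_div_mul (a b : ℂ) : conj (a / b) * a = b * (normSq (a / b) : ℂ) := by
  rcases eq_or_ne b 0 with hb | hb
  · simp [hb]
  · have hb' : conj b ≠ 0 := by simpa using hb
    rw [normSq_eq_conj_mul_self, map_div₀]
    field_simp

/-- the multiplicative reading of (1.61), `∂¹_μ(p′) = v_μ(p′+l)·∂_μ(p′+l)`, gives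
`\overline{v_μ(p′+l)}·∂¹_μ(p′) = ∂_μ(p′+l)·|v_μ(p′+l)|²`. [folklore] -/
theorem conj_mul_of_eq_mul {dOneμ w z : ℂ} (h : dOneμ = w * z) :
    conj w * dOneμ = z * (normSq w : ℂ) := by
  rw [h, normSq_eq_conj_mul_self]; ring

omit [Fintype ι] [DecidableEq ι] in
/-- for `v = vOf` (1.61): `\overline{v_μ(p′+l)} ∂¹_μ(p′) = ∂_μ(p′+l) |v_μ(p′+l)|²` (GAPS C-adv4-31).
[folklore] -/
theorem conj_vOf_mul (dOneμ : ℂ) (dμ : ι → ℂ) (l : ι) :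
    conj (vOf dOneμ dμ l) * dOneμ = dμ l * (normSq (vOf dOneμ dμ l) : ℂ) :=
  conj_div_mul dOneμ (dμ l)

/-- (1.62): `φ_μ(p′) = Σ_l |u(p′+l)|² |v_μ(p′+l)|² / Δ(p′+l)`.
[cite: Balaban1984PropagatorsI, (1.62) p.28] -/
def phiSym (u v : ι → ℂ) (D : ι → ℂ) : ℂ := ∑ l, (normSq (u l) : ℂ) * (normSq (v l) : ℂ) / D l

/-- `S(p′) = Σ_{l′} |u(p′+l′)|² Δ₀²(p′)/Δ²(p′+l′)`, the inverted alias sum of both expressions of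
(1.63). [cite: Balaban1984PropagatorsI, (1.63) p.28] -/
def sSym (u : ι → ℂ) (D : ι → ℂ) (Δ₀ : ℂ) : ℂ := ∑ l, (normSq (u l) : ℂ) * Δ₀ ^ 2 / D l ^ 2

/-- `N(p′) = Σ_ν |∂¹_ν(p′)|²/(Δ₀²(p′)φ_ν(p′))`, the inverted direction sum of (1.63).
[cite: Balaban1984PropagatorsI, (1.63) p.28] -/
def nSym (dOne : κ → ℂ) (phiDir : κ → ℂ) (Δ₀ : ℂ) : ℂ :=
  ∑ ν, (normSq (dOne ν) : ℂ) / (Δ₀ ^ 2 * phiDir ν)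

/-! ## §2. The two expressions of (1.63) -/

/-- the common first term `Δ₀(p′)/Δ(p′+l)·\overline{u(p′+l)v_μ(p′+l)}·(Δ₀(p′)φ_μ(p′))⁻¹·B̃_μ(p′)`.
[cite: Balaban1984PropagatorsI, (1.63) p.28] -/
def head163 (u v : ι → ℂ) (D : ι → ℂ) (Δ₀ : ℂ) (Bt : κ → ℂ) (μ : κ) (l : ι) : ℂ :=
  Δ₀ / D l * conj (u l * v l) * (1 / (Δ₀ * phiSym u v D)) * Bt μ

/-- the bracket of the FIRST expression, bars as in (1.60)/(1.62) (no bar on `∂¹_μ(p′)`):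
`[∂_μ(p′+l) ū(p′+l) Δ₀²/Δ²(p′+l)·S⁻¹ − \overline{u v_μ}(p′+l) Δ₀/Δ(p′+l)·(Δ₀φ_μ)⁻¹·∂¹_μ(p′)]`.
[cite: Balaban1984PropagatorsI, (1.63) p.28] -/
def bracket163 (u v dμ : ι → ℂ) (D : ι → ℂ) (Δ₀ : ℂ) (dOne : κ → ℂ) (μ : κ) (l : ι) : ℂ :=
  dμ l * (conj (u l) * Δ₀ ^ 2 / D l ^ 2) * (sSym u D Δ₀)⁻¹
    - conj (u l * v l) * Δ₀ / D l * (1 / (Δ₀ * phiSym u v D)) * dOne μ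

/-- the FIRST expression of (1.63), bars corrected (`Σ_λ \overline{∂¹_λ(p′)}/(Δ₀φ_λ)·Δ₀⁻¹·B̃_λ`).
[cite: Balaban1984PropagatorsI, (1.63) p.28] -/
def first163 (u v dμ : ι → ℂ) (D : ι → ℂ) (Δ₀ : ℂ) (dOne phiDir Bt : κ → ℂ) (μ : κ) (l : ι) : ℂ :=
  head163 u v D Δ₀ Bt μ l
    + bracket163 u v dμ D Δ₀ dOne μ l
      * ((nSym dOne phiDir Δ₀)⁻¹ * ∑ lam, conj (dOne lam) / (Δ₀ * phiDir lam) * Δ₀⁻¹ * Bt lam)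

/-- the `l′`-summand of the SECOND expression:
`∂_μ(p′+l) ū(p′+l)|u(p′+l′)|²/(Δ(p′+l)Δ(p′+l′))·Δ₀²·[|v_μ(p′+l′)|²/Δ(p′+l) − |v_μ(p′+l)|²/Δ(p′+l′)]`.
[cite: Balaban1984PropagatorsI, (1.63) p.28] -/
def summand163 (u v dμ : ι → ℂ) (D : ι → ℂ) (Δ₀ : ℂ) (l l' : ι) : ℂ :=
  dμ l * (conj (u l) * (normSq (u l') : ℂ) / (D l * D l')) * Δ₀ ^ 2
    * ((normSq (v l') : ℂ) / D l - (normSq (v l) : ℂ) / D l')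

/-- the SECOND expression of (1.63), verbatim grouping.
[cite: Balaban1984PropagatorsI, (1.63) p.28] -/
def second163 (u v dμ : ι → ℂ) (D : ι → ℂ) (Δ₀ : ℂ) (dOne phiDir Bt : κ → ℂ) (μ : κ) (l : ι) : ℂ :=
  head163 u v D Δ₀ Bt μ l
    + (∑ l' ∈ univ.erase l, summand163 u v dμ D Δ₀ l l') * (sSym u D Δ₀)⁻¹
      * (1 / (Δ₀ * phiSym u v D)) * (nSym dOne phiDir Δ₀)⁻¹
      * ∑ lam, conj (dOne lam) / (Δ₀ * phiDir lam) * Bt lam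

omit [Fintype ι] [DecidableEq ι] in
/-- the `l′ = l` summand vanishes identically. [folklore] -/
theorem summand_self (u v dμ : ι → ℂ) (D : ι → ℂ) (Δ₀ : ℂ) (l : ι) :
    summand163 u v dμ D Δ₀ l l = 0 := by
  simp [summand163]

/-- hence `Σ_{l′≠l} = Σ_{l′}`. [folklore] -/
theorem sum_erase_eq_sum (u v dμ : ι → ℂ) (D : ι → ℂ) (Δ₀ : ℂ) (l : ι) :
    ∑ l' ∈ univ.erase l, summand163 u v dμ D Δ₀ l l' = ∑ l', summand163 u v dμ D Δ₀ l l' :=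
  sum_erase _ (summand_self u v dμ D Δ₀ l)

omit [DecidableEq ι] in
/-- the alias sum of the second expression in closed form:
`Σ_{l′} … = ∂_μ ū Δ₀²/Δ²(p′+l)·φ_μ(p′) − ∂_μ ū |v_μ(p′+l)|²/Δ(p′+l)·S(p′)`. [folklore] -/
theorem sum_second_eq (u v dμ : ι → ℂ) (D : ι → ℂ) (Δ₀ : ℂ) (l : ι) :
    ∑ l', summand163 u v dμ D Δ₀ l l'
      = dμ l * conj (u l) * Δ₀ ^ 2 / D l ^ 2 * phiSym u v D
        - dμ l * conj (u l) * (normSq (v l) : ℂ) / D l * sSym u D Δ₀ := by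
  simp only [summand163, phiSym, sSym, mul_sum, ← sum_sub_distrib]
  refine sum_congr rfl fun l' _ => ?_
  ring

/-- MAIN. The bar-corrected FIRST expression of (1.63) equals the SECOND at the alias `l`, given
`Δ₀(p′) ≠ 0`, `S(p′) ≠ 0`, `φ_μ(p′) ≠ 0` and the single relation `\overline{v_μ(p′+l)}∂¹_μ(p′) =
∂_μ(p′+l)|v_μ(p′+l)|²` (which (1.61) gives: `conj_vOf_mul`, `conj_mul_of_eq_mul`). No hypothesis on
`Δ(p′+·)`, `φ_ν`, `B̃`, `N`. [cite: Balaban1984PropagatorsI, (1.63) p.28] -/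
theorem first163_eq_second163 (u v dμ : ι → ℂ) (D : ι → ℂ) (Δ₀ : ℂ) (dOne phiDir Bt : κ → ℂ)
    (μ : κ) (hΔ : Δ₀ ≠ 0) (hS : sSym u D Δ₀ ≠ 0) (hφ : phiSym u v D ≠ 0) (l : ι)
    (hv' : conj (v l) * dOne μ = dμ l * (normSq (v l) : ℂ)) :
    first163 u v dμ D Δ₀ dOne phiDir Bt μ l = second163 u v dμ D Δ₀ dOne phiDir Bt μ l := by
  have htail : ∑ lam, conj (dOne lam) / (Δ₀ * phiDir lam) * Δ₀⁻¹ * Bt lam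
      = Δ₀⁻¹ * ∑ lam, conj (dOne lam) / (Δ₀ * phiDir lam) * Bt lam := by
    rw [mul_sum]; exact sum_congr rfl fun lam _ => by ring
  have key : bracket163 u v dμ D Δ₀ dOne μ l * Δ₀⁻¹
      = (∑ l' ∈ univ.erase l, summand163 u v dμ D Δ₀ l l') * (sSym u D Δ₀)⁻¹
          * (1 / (Δ₀ * phiSym u v D)) := by
    rw [sum_erase_eq_sum, sum_second_eq]
    have e : conj (u l * v l) * Δ₀ / D l * (1 / (Δ₀ * phiSym u v D)) * dOne μ
        = conj (u l) * (conj (v l) * dOne μ) * Δ₀ / D l * (1 / (Δ₀ * phiSym u v D)) := by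
      rw [map_mul]; ring
    rw [bracket163, e, hv']
    field_simp
  rw [first163, second163, htail]
  calc head163 u v D Δ₀ Bt μ l + bracket163 u v dμ D Δ₀ dOne μ l
        * ((nSym dOne phiDir Δ₀)⁻¹ * (Δ₀⁻¹ * ∑ lam, conj (dOne lam) / (Δ₀ * phiDir lam) * Bt lam))
      = head163 u v D Δ₀ Bt μ l + bracket163 u v dμ D Δ₀ dOne μ l * Δ₀⁻¹
        * (nSym dOne phiDir Δ₀)⁻¹ * ∑ lam, conj (dOne lam) / (Δ₀ * phiDir lam) * Bt lam := by ring
    _ = _ := by rw [key]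

/-- MAIN with (1.61) read multiplicatively, `∂¹_μ(p′) = v_μ(p′+l)·∂_μ(p′+l)` (the reading that
includes the removable point `∂_μ(p′+l) = 0`; the lineage's `B5Prop11Fiber.d1Sym_eq_vSym_mul` has this
shape). [cite: Balaban1984PropagatorsI, (1.61), (1.63) p.28] -/
theorem first163_eq_second163_of_eq_mul (u v dμ : ι → ℂ) (D : ι → ℂ) (Δ₀ : ℂ)
    (dOne phiDir Bt : κ → ℂ) (μ : κ) (hΔ : Δ₀ ≠ 0) (hS : sSym u D Δ₀ ≠ 0)
    (hφ : phiSym u v D ≠ 0) (l : ι) (h161 : dOne μ = v l * dμ l) :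
    first163 u v dμ D Δ₀ dOne phiDir Bt μ l = second163 u v dμ D Δ₀ dOne phiDir Bt μ l :=
  first163_eq_second163 u v dμ D Δ₀ dOne phiDir Bt μ hΔ hS hφ l (conj_mul_of_eq_mul h161)

/-- MAIN with `v_μ = ∂¹_μ(p′)/∂_μ(p′+·)` literally as in (1.61) (`vOf`): no relation hypothesis at
all. [cite: Balaban1984PropagatorsI, (1.61), (1.63) p.28] -/
theorem first163_eq_second163_vOf (u dμ : ι → ℂ) (D : ι → ℂ) (Δ₀ : ℂ) (dOne phiDir Bt : κ → ℂ)
    (μ : κ) (hΔ : Δ₀ ≠ 0) (hS : sSym u D Δ₀ ≠ 0) (hφ : phiSym u (vOf (dOne μ) dμ) D ≠ 0) (l : ι) :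
    first163 u (vOf (dOne μ) dμ) dμ D Δ₀ dOne phiDir Bt μ l
      = second163 u (vOf (dOne μ) dμ) dμ D Δ₀ dOne phiDir Bt μ l :=
  first163_eq_second163 u _ dμ D Δ₀ dOne phiDir Bt μ hΔ hS hφ l (conj_vOf_mul (dOne μ) dμ l)

omit [DecidableEq ι] in
/-- `S(p′) ≠ 0` from real data: `Δ(p′+l) > 0`, `Δ₀(p′) > 0`, some `u(p′+l₀) ≠ 0`. [folklore] -/
theorem sSym_ne_zero (u : ι → ℂ) (Dr : ι → ℝ) (Δ₀r : ℝ) (hD : ∀ l, 0 < Dr l) (hΔ : 0 < Δ₀r)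
    (l₀ : ι) (hu : u l₀ ≠ 0) : sSym u (fun l => (Dr l : ℂ)) (Δ₀r : ℂ) ≠ 0 := by
  have hcast : sSym u (fun l => (Dr l : ℂ)) (Δ₀r : ℂ)
      = ((∑ l, normSq (u l) * Δ₀r ^ 2 / Dr l ^ 2 : ℝ) : ℂ) := by
    unfold sSym; push_cast; rfl
  rw [hcast, ofReal_ne_zero]
  refine ne_of_gt (lt_of_lt_of_le ?_ (single_le_sum (f := fun l => normSq (u l) * Δ₀r ^ 2 / Dr l ^ 2)
    (fun l _ => div_nonneg (mul_nonneg (normSq_nonneg _) (sq_nonneg _)) (sq_nonneg _)) (mem_univ l₀)))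
  exact div_pos (mul_pos (normSq_pos.mpr hu) (pow_pos hΔ 2)) (pow_pos (hD l₀) 2)

omit [DecidableEq ι] in
/-- `φ_μ(p′) ≠ 0` from real data: `Δ(p′+l) > 0`, some `u(p′+l₀)v_μ(p′+l₀) ≠ 0`. [folklore] -/
theorem phiSym_ne_zero (u v : ι → ℂ) (Dr : ι → ℝ) (hD : ∀ l, 0 < Dr l) (l₀ : ι) (hu : u l₀ ≠ 0)
    (hvl : v l₀ ≠ 0) : phiSym u v (fun l => (Dr l : ℂ)) ≠ 0 := by
  have hcast : phiSym u v (fun l => (Dr l : ℂ))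
      = ((∑ l, normSq (u l) * normSq (v l) / Dr l : ℝ) : ℂ) := by
    unfold phiSym; push_cast; rfl
  rw [hcast, ofReal_ne_zero]
  refine ne_of_gt (lt_of_lt_of_le ?_ (single_le_sum (f := fun l => normSq (u l) * normSq (v l) / Dr l)
    (fun l _ => div_nonneg (mul_nonneg (normSq_nonneg _) (normSq_nonneg _)) (hD l).le) (mem_univ l₀)))
  exact div_pos (mul_pos (normSq_pos.mpr hu) (normSq_pos.mpr hvl)) (hD l₀)

/-- MAIN, real-data form: `Δ(p′+l) > 0`, `Δ₀(p′) > 0`, one alias `l₀` with `u(p′+l₀) ≠ 0`,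
`v_μ(p′+l₀) ≠ 0` («a well-defined positive function», `Δ₀φ_μ > 0`), and (1.61) multiplicatively:
first expression (bars corrected) = second expression. [cite: Balaban1984PropagatorsI, (1.63) p.28] -/
theorem first163_eq_second163_of_pos (u v dμ : ι → ℂ) (Dr : ι → ℝ) (Δ₀r : ℝ)
    (dOne phiDir Bt : κ → ℂ) (μ : κ) (hD : ∀ l, 0 < Dr l) (hΔ : 0 < Δ₀r) (l₀ : ι) (hu : u l₀ ≠ 0)
    (hvl : v l₀ ≠ 0) (hv : ∀ l, dOne μ = v l * dμ l) (l : ι) :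
    first163 u v dμ (fun l => (Dr l : ℂ)) (Δ₀r : ℂ) dOne phiDir Bt μ l
      = second163 u v dμ (fun l => (Dr l : ℂ)) (Δ₀r : ℂ) dOne phiDir Bt μ l :=
  first163_eq_second163 u v dμ _ _ dOne phiDir Bt μ (ofReal_ne_zero.mpr hΔ.ne')
    (sSym_ne_zero u Dr Δ₀r hD hΔ l₀ hu) (phiSym_ne_zero u v Dr hD l₀ hu hvl) l
    (conj_mul_of_eq_mul (hv l))

/-! ## §3. The printed placement of the bars -/

/-- the FIRST expression of (1.63) with the bars AS PRINTED: `\overline{∂¹_μ(p′)}` inside the bracket,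
`∂¹_λ(p′)` (no bar) in `Σ_λ`. [cite: Balaban1984PropagatorsI, (1.63) p.28] -/
def firstPrinted163 (u v dμ : ι → ℂ) (D : ι → ℂ) (Δ₀ : ℂ) (dOne phiDir Bt : κ → ℂ) (μ : κ)
    (l : ι) : ℂ :=
  head163 u v D Δ₀ Bt μ l
    + (dμ l * (conj (u l) * Δ₀ ^ 2 / D l ^ 2) * (sSym u D Δ₀)⁻¹
        - conj (u l * v l) * Δ₀ / D l * (1 / (Δ₀ * phiSym u v D)) * conj (dOne μ))
      * ((nSym dOne phiDir Δ₀)⁻¹ * ∑ lam, dOne lam / (Δ₀ * phiDir lam) * Δ₀⁻¹ * Bt lam)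

omit [DecidableEq ι] in
/-- when every `∂¹_ν(p′)` is real (`e^{ip′_ν} = ±1`) the printed and the corrected first expressions
coincide (so there the printed first expression also equals the second one) — the momenta at which
the cell's numerics found agreement (B5.lean header, E6b; GAPS G-B5-14 (ii)). [folklore] -/
theorem firstPrinted163_eq_first163 (u v dμ : ι → ℂ) (D : ι → ℂ) (Δ₀ : ℂ) (dOne phiDir Bt : κ → ℂ)
    (μ : κ) (hreal : ∀ ν, conj (dOne ν) = dOne ν) (l : ι) :
    firstPrinted163 u v dμ D Δ₀ dOne phiDir Bt μ l = first163 u v dμ D Δ₀ dOne phiDir Bt μ l := by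
  simp only [firstPrinted163, first163, bracket163, hreal]

end

end Literature.MathematicalPhysics.QuantumFieldTheory.Balaban1983to89.B5Symbol163
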